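import Summits.KontsevichZagierPeriods.Zeta5Search.TwoTaleOmega.StepAEFR

/-!
# (bmiss)@Ω — direction `aef`: the recurrence of the sign-free forms `U1`, `U0`, generic in the certificate (cell `pub-zeta5`, cert-2 gen 5)

HONEST FRAMING: systematic search; recurrence certificates; no irrationality claim unless certified. Pure finite algebra over `ℚ`;
no named fact, no `sorry`.

`rec_aef` combines the generic first tale `StepAEFL.recL_aef` (telescoper `cL`, certificate `XL`, identity `IdL`) and the generic second tale
`StepAEFR.recR_aef` (R-side operator `cR`, lattice certificate `XR`, identity `IdRb`, rule box) into
`Σ_{k<4} cL_k·U1(p+kδ_aef) = 0` and `Σ_{k<4} cL_k·U0(p+kδ_aef) = 0`, using the PROPORTIONALITY `hd·cR_k = hn·cL_k` (`hn ≠ 0`) of the two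
operators (cert-2 g4 `TwoTaleTelescopeAefLead*.cAef<n>_prop<k>`, `hnAef<n>_ne_zero`) and the truncation bookkeeping `lam0_eq_of_le`
(`d` grows by `3k` along `δ_aef`).  The 81 family instances supply `cL, XL, cR, XR, hd, hn` and the two identities.
-/

noncomputable section

open Finset Polynomial
open Literature.NumberTheory.Irrationality.Zudilin2014
open Summit.KontsevichZagierPeriods.Zeta5Search.FormalBarnes
open Summit.KontsevichZagierPeriods.Zeta5Search.Certificates.TwoTaleTelescope

namespace Summit.KontsevichZagierPeriods.Zeta5Search.TwoTaleOmega

namespace Pt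

variable {p : Pt}

/-- The first-tale truncation of `U0` at `p+kδ_aef` may be raised to the common `d⁺(p) + 10` (`d` grows by `3k ≤ 9`). -/
theorem lam0_dExp_eq_aef {k : ℤ} (hk : (p.addAEF k).Omega) (hk0 : 0 ≤ k) (hk3 : k ≤ 3) (s : ℤ) :
    lam0 (dExp (p.addAEF k).t1a (p.addAEF k).t1b) s (p.addAEF k).vL = lam0 (dExp p.t1a p.t1b + 10) s (p.addAEF k).vL := by
  refine (lam0_eq_of_le s _ (vL_natDegree_le_w hk) ?_).symm
  unfold dExp
  rw [sum_t1a_sub_sum_t1b, sum_t1a_sub_sum_t1b, dInt_addAEF]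
  omega

/-- **The `aef`-recurrence of the sign-free forms, generic certificate.**  For `p, …, p+3δ_aef ∈ Ω` with `p` in the aef rule box, an
L-telescoper `cL` with certificate `XL` (`IdL`), an R-operator `cR` with lattice certificate `XR` (`IdRb`), proportional by `hd·cR_k = hn·cL_k` with
`hn ≠ 0`: `Σ_k cL_k·U1(p+kδ) = 0` and `Σ_k cL_k·U0(p+kδ) = 0`. -/
theorem rec_aef {cL cR : Fin 4 → ℚ} {XL XR : ℚ[X]} {hd hn : ℚ} (hXL : XL.natDegree ≤ 6) (hXR : XR.natDegree ≤ 9)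
    (hcL : p.IdL cL XL) (hcR : p.IdRb cR XR) (hprop : ∀ k : Fin 4, hd * cR k = hn * cL k) (hn0 : hn ≠ 0) (hb : p.AefBox)
    (h0 : p.Omega) (h1 : (p.addAEF 1).Omega) (h2 : (p.addAEF 2).Omega) (h3 : (p.addAEF 3).Omega) :
    (cL 0 * p.U1 + cL 1 * (p.addAEF 1).U1 + cL 2 * (p.addAEF 2).U1 + cL 3 * (p.addAEF 3).U1 = 0) ∧
    (cL 0 * p.U0 + cL 1 * (p.addAEF 1).U0 + cL 2 * (p.addAEF 2).U0 + cL 3 * (p.addAEF 3).U0 = 0) := by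
  have hL := recL_aef hXL hcL h0 h1 h2 h3
  have hR := recR_aef hXR hcR hb h0 h1 h2 h3
  have p0 := hprop 0; have p1 := hprop 1; have p2 := hprop 2; have p3 := hprop 3
  -- transfer the second-tale relations from `cR` to `cL`
  have hR1 : cL 0 * altE1 p.nodeR p.vR + cL 1 * altE1 (p.addAEF 1).nodeR (p.addAEF 1).vR
      + cL 2 * altE1 (p.addAEF 2).nodeR (p.addAEF 2).vR + cL 3 * altE1 (p.addAEF 3).nodeR (p.addAEF 3).vR = 0 := by
    have h : hn * (cL 0 * altE1 p.nodeR p.vR + cL 1 * altE1 (p.addAEF 1).nodeR (p.addAEF 1).vR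
        + cL 2 * altE1 (p.addAEF 2).nodeR (p.addAEF 2).vR + cL 3 * altE1 (p.addAEF 3).nodeR (p.addAEF 3).vR) = 0 := by
      linear_combination hd * hR.1 - altE1 p.nodeR p.vR * p0 - altE1 (p.addAEF 1).nodeR (p.addAEF 1).vR * p1
        - altE1 (p.addAEF 2).nodeR (p.addAEF 2).vR * p2 - altE1 (p.addAEF 3).nodeR (p.addAEF 3).vR * p3
    exact (mul_eq_zero.1 h).resolve_left hn0
  have hR0 : cL 0 * altE0 0 p.nodeR p.vR + cL 1 * altE0 0 (p.addAEF 1).nodeR (p.addAEF 1).vR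
      + cL 2 * altE0 0 (p.addAEF 2).nodeR (p.addAEF 2).vR + cL 3 * altE0 0 (p.addAEF 3).nodeR (p.addAEF 3).vR = 0 := by
    have h : hn * (cL 0 * altE0 0 p.nodeR p.vR + cL 1 * altE0 0 (p.addAEF 1).nodeR (p.addAEF 1).vR
        + cL 2 * altE0 0 (p.addAEF 2).nodeR (p.addAEF 2).vR + cL 3 * altE0 0 (p.addAEF 3).nodeR (p.addAEF 3).vR) = 0 := by
      linear_combination hd * hR.2 - altE0 0 p.nodeR p.vR * p0 - altE0 0 (p.addAEF 1).nodeR (p.addAEF 1).vR * p1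
        - altE0 0 (p.addAEF 2).nodeR (p.addAEF 2).vR * p2 - altE0 0 (p.addAEF 3).nodeR (p.addAEF 3).vR * p3
    exact (mul_eq_zero.1 h).resolve_left hn0
  have e0 : lam0 (dExp p.t1a p.t1b) p.nodeL p.vL = lam0 (dExp p.t1a p.t1b + 10) p.nodeL p.vL :=
    (lam0_eq_of_le _ _ (vL_natDegree_le_w h0) (by omega)).symm
  have e1 := lam0_dExp_eq_aef h1 (by norm_num) (by norm_num) (p.addAEF 1).nodeL
  have e2 := lam0_dExp_eq_aef h2 (by norm_num) (by norm_num) (p.addAEF 2).nodeL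
  have e3 := lam0_dExp_eq_aef h3 (by norm_num) (by norm_num) (p.addAEF 3).nodeL
  unfold U1 U0
  rw [e0, e1, e2, e3]
  constructor
  · linear_combination hL.1 + (1 / 4 : ℚ) * hR1
  · linear_combination hL.2 + (1 / 2 : ℚ) * hR0

/-- **The `aef`-step of the Ω-induction** (with `cL 3 ≠ 0` from the rule data): if `U1`, `U0` vanish at `p, p+δ, p+2δ`, they vanish at `p+3δ`. -/
theorem step_aef {cL cR : Fin 4 → ℚ} {XL XR : ℚ[X]} {hd hn : ℚ} (hXL : XL.natDegree ≤ 6) (hXR : XR.natDegree ≤ 9)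
    (hcL : p.IdL cL XL) (hcR : p.IdRb cR XR) (hprop : ∀ k : Fin 4, hd * cR k = hn * cL k) (hn0 : hn ≠ 0) (hb : p.AefBox)
    (h0 : p.Omega) (h1 : (p.addAEF 1).Omega) (h2 : (p.addAEF 2).Omega) (h3 : (p.addAEF 3).Omega) (hc : cL 3 ≠ 0)
    (u0 : p.U1 = 0 ∧ p.U0 = 0) (u1 : (p.addAEF 1).U1 = 0 ∧ (p.addAEF 1).U0 = 0) (u2 : (p.addAEF 2).U1 = 0 ∧ (p.addAEF 2).U0 = 0) :
    (p.addAEF 3).U1 = 0 ∧ (p.addAEF 3).U0 = 0 := by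
  have h := rec_aef hXL hXR hcL hcR hprop hn0 hb h0 h1 h2 h3
  rw [u0.1, u1.1, u2.1, u0.2, u1.2, u2.2] at h
  simp only [mul_zero, zero_add] at h
  exact ⟨(mul_eq_zero.1 h.1).resolve_left hc, (mul_eq_zero.1 h.2).resolve_left hc⟩

end Pt

end Summit.KontsevichZagierPeriods.Zeta5Search.TwoTaleOmega

end
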